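import Summits.CriticalPhenomena.PercolationContinuityZ3.Theses.PercVarianceSandwich
import Summits.CriticalPhenomena.PercolationContinuityZ3.Theses.PercDebrisSweep
import Literature.Probability.Percolation.BernoulliPercolationProofs
import Literature.Probability.Percolation.KestenZhangTail

/-!
# Birth skeleton (BC3) for the crux `FiniteClusterMomentsOfTheta` (stmt-CriticalPhenomena-6065)

Route `route-CriticalPhenomena-PercVarianceSandwich` (sub-problem `PercolationContinuityZ3`), crux decl
`Summit.CriticalPhenomena.PercolationContinuityZ3.Theses.PercVarianceSandwich.FiniteClusterMomentsOfTheta`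
(rank 2, "B"): for every `p` with `θ(p) > 0` and every `k`, the truncated `k`-point connectivity of bond
percolation on `ℤ³` is summable over `k`-tuples,
`Σ_(x₁,…,x_k) P_p(0 ↔ x₁, …, 0 ↔ x_k, |C(0)| < ∞) < ∞`, i.e. `E_p[|C(0)|^k ; |C(0)| < ∞] < ∞` (all orders).

THE LINE (Grimmett's order (8.65) ⇒ layer cake ⇒ moments, cut by regime). `θ(p) > 0` forces `p_c ≤ p`
(infimum definition of `p_c`; `criticalProb_le_of_theta_pos'` below), so the crux splits EXACTLY into the
supercritical regime `p > p_c` (a theorem in print: Kesten–Zhang 1990 = Grimmett 1999 Thm (8.65), in tree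
as the named fact `Literature.Probability.Percolation.Grimmett1999_thm_8_65`) and the single point `p = p_c`
under the hypothesis `θ(p_c) > 0` (the live, hypothetical case — "no sprinkling"). At any `p` the currency
between the two halves and the crux is the finite-cluster VOLUME TAIL `volTail p m = P_p(m ≤ |C(0)| < ∞)`
(the quantity of (8.65)/(8.66) and of the sibling crux `PercDebrisSweep.FiniteClusterVolumeTail`), in the
weakest form the crux can use: ALL POLYNOMIAL TAIL-MOMENTS SUMMABLE, `∀ j, Σ_m (m+1)^j volTail p m < ∞`
(super-polynomial smallness of large finite clusters). Three registered stubs: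

* STUB 1 `stub_supercriticalTailMoments` (KNOWN THEOREM, XL to formalise): `p_c < p ⇒ ∀ j, Σ_m (m+1)^j
  P_p(m ≤ |C| < ∞) < ∞`. In print twice over: Grimmett 1999 Thm (8.65) p. 216 (`≤ exp(−η m^{2/3})`,
  Kesten–Zhang 1990) and already Thm (8.64)/(8.18)+(8.21) (`≤ exp(−η m^{1/3})`, exponential RADIUS decay via
  a slab percolating at `p`, Chayes–Chayes–Newman 1987 / Grimmett–Marstrand 1990; slab technology is LEGAL
  here: `p > p_c`). PROVED BELOW from the in-tree named fact: `supercriticalTailMoments_of_KZ :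
  Grimmett1999_thm_8_65 → SupercriticalTailMoments` (series estimate `summable_pow_mul_of_stretchedExp`).
* STUB 2 `stub_criticalTailMoments` (OPEN — LOAD-BEARING): **at a percolating `p_c`, large finite clusters
  are super-polynomially rare** — `θ(p_c) > 0 ⇒ ∀ j, Σ_m (m+1)^j P_{p_c}(m ≤ |C(0)| < ∞) < ∞`. This is the
  `p = p_c` instance of the line stated one level BELOW the crux (the one-variable law of `|C|`, not
  `k`-point functions); it is implied by the `p_c`-instance of the sibling crux stmt-CriticalPhenomena-0943
  `PercDebrisSweep.FiniteClusterVolumeTail` (`criticalTailMoments_of_volumeTailItem`, PROVED below) and it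
  implies the `p_c`-instance of the crux through STUB 3. Vacuously true in the real world (`θ(p_c) = 0`);
  refutable only by first exhibiting `θ(p_c) > 0` (route kill criterion: B dies only together with the
  conjunct). Why it might fail: nothing in print confines the finite pockets of a percolating phase AT the
  same `p` — every engine (Grimmett (8.61)–(8.65), Pisztora 1996) runs through a slab percolating at `p`
  (Thm (7.2), `p_c(slab) ↓ p_c` from above, none at `p_c`: DST 2016 / BGN 1991 half-space);
  `Literature.Barriers.CriticalPhenomena.SprinklingRenormalisation` is met head-on exactly here; and in the
  Aizenman–Newman `1/r²` family the percolating critical point HAS fat finite clusters (Imbrie–Newman 1988).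
* STUB 3 `stub_truncMomentsOfTailMoments` (M/L, PROVABLE NOW, every `p`): **moments from tails** —
  `(∀ j, Σ_m (m+1)^j volTail p m < ∞) ⇒ ∀ k, Σ_(x : Fin k → ℤ³) P_p(⋂ᵢ {0 ↔ xᵢ} ∖ {0 ↔ ∞}) < ∞`.
  Proof sketch: `{0 ↔ y} = {y ∈ C(0)}` (`openConn`/`openCluster` are the same `Reachable`) and
  `{0 ↔ ∞}ᶜ = {C(0) finite}` (`percolatesAt`); all events measurable (`measurableSet_openConn_holds`,
  `measurableSet_percolatesAt_holds`, PercolationProofs / BernoulliPercolationProofs); Tonelli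
  (`lintegral_tsum`) gives `Σ_x μ(E_x) = ∫ #{x : Fin k → C(0)} · 1_{C(0) finite} dμ = E[|C|^k ; fin]`
  (as an `ℝ≥0∞` sum; `Summable` of the nonnegative real family follows from finiteness), and the layer cake
  `E[|C|^k; fin] = Σ_{m ≥ 1} (m^k − (m−1)^k) P(m ≤ |C| < ∞) ≤ k Σ_m (m+1)^{k-1} volTail p m < ∞`
  (`k = 0`: finite index type, `Summable.of_finite`).

Composition (kernel-checked, no `sorry`): `FiniteClusterMomentsOfTheta_of :
stub_supercriticalTailMoments → stub_criticalTailMoments → stub_truncMomentsOfTailMoments →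
FiniteClusterMomentsOfTheta` (hypotheses typed by the name-keyed aliases `__Registered.stub_*`): given
`θ(p) > 0`, `p_c ≤ p`; if `p_c < p` use STUB 3 ∘ STUB 1; else `p = p_c` as points of `[0,1]`
(`Subtype.ext`, `coe_criticalProbI`) and STUB 3 ∘ STUB 2.

DISPROOF USED: none exists for this crux (`ledger crux ls stmt-CriticalPhenomena-6065`: no workfiles, no
`Disproof.lean`, no landed Negative lemma, 2026-08-17). Negatives index of the summit: no finite-cluster-tail /
truncated-moment statement. Honest-piece check: STUB 1 is a theorem in print and follows from the in-tree
fact (proved); STUB 3 is a theorem (layer cake + Tonelli); STUB 2 is the one open piece, sandwiched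
`0943(p_c) ⇒ STUB 2 ⇒ (with STUB 3) B(p_c)`, and the supercritical regime of B is a CONSEQUENCE of B
(`supercritTruncMoments_of_crux`, via `θ(p) > 0` for `p > p_c`).
-/

noncomputable section

namespace Summit.CriticalPhenomena.PercolationContinuityZ3.Cruxes.FiniteClusterMomentsOfTheta.Birth

open MeasureTheory Literature.Probability.Percolation Literature.Probability.LatticeModels
open Summit.CriticalPhenomena.PercolationContinuityZ3.Theses.PercVarianceSandwich (FiniteClusterMomentsOfTheta)

/-! ## Objects of the line -/

/-- Bond percolation on `ℤ³` at density `p`. -/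
abbrev μ (p : unitInterval) : Measure (BondConfig (Site 3)) := bondPercolation (zdGraph 3) p

/-- The finite-cluster volume tail `P_p(m ≤ |C(0)| < ∞)` (Grimmett 1999, (8.66); spelled exactly as in
`Literature.Probability.Percolation.Grimmett1999_thm_8_65` and `PercDebrisSweep.FiniteClusterVolumeTail`). -/
def volTail (p : unitInterval) (m : ℕ) : ℝ :=
  (μ p).real {ω | (m : ℕ∞) ≤ (openCluster ω 0).encard ∧ (openCluster ω 0).Finite}

/-- The truncated `k`-point connectivity `P_p(0 ↔ x₁, …, 0 ↔ x_k, |C(0)| < ∞)` (the crux's summand). -/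
def tauFk (p : unitInterval) (k : ℕ) (x : Fin k → Site 3) : ℝ :=
  (μ p).real ((⋂ i, openConn 0 (x i)) \ percolatesAt 0)

/-- All truncated moments finite at `p`: `∀ k, Σ_(x : Fin k → ℤ³) τᶠ_k(x) < ∞` (the crux at one `p`). -/
def TruncMomentsFinite (p : unitInterval) : Prop := ∀ k : ℕ, Summable (tauFk p k)

/-- All polynomial tail-moments of the finite-cluster volume summable at `p`:
`∀ j, Σ_m (m+1)^j P_p(m ≤ |C(0)| < ∞) < ∞` (super-polynomially rare large finite clusters). -/
def TailMomentsSummable (p : unitInterval) : Prop :=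
  ∀ j : ℕ, Summable fun m : ℕ => ((m : ℝ) + 1) ^ j * volTail p m

/-- The crux is literally `∀ p, θ(p) > 0 → TruncMomentsFinite p`. -/
theorem crux_iff :
    FiniteClusterMomentsOfTheta ↔ ∀ p : unitInterval, 0 < theta (zdGraph 3) 0 p → TruncMomentsFinite p :=
  Iff.rfl

/-! ## The three stub statements -/

/-- STUB 1 statement (the supercritical regime, a theorem in print): `p_c < p ⇒` all tail-moments summable. -/
def SupercriticalTailMoments : Prop :=
  ∀ p : unitInterval, criticalProb (zdGraph 3) (0 : Site 3) < (p : ℝ) → TailMomentsSummable p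

/-- STUB 2 statement (the live case, one level below the crux): at a percolating `p_c`, all tail-moments of
the finite-cluster volume are summable. -/
def CriticalTailMoments : Prop :=
  0 < theta (zdGraph 3) (0 : Site 3) (criticalProbI 3) → TailMomentsSummable (criticalProbI 3)

/-- STUB 3 statement (moments from tails, at every `p`). -/
def TruncMomentsOfTailMoments : Prop :=
  ∀ p : unitInterval, TailMomentsSummable p → TruncMomentsFinite p

/-! ## Registered stubs -/

/-- **STUB 1 `supercriticalTailMoments`** (KNOWN; XL to formalise from scratch, `exact` from the fact): for
`p > p_c(ℤ³)` and every `j`, `Σ_m (m+1)^j P_p(m ≤ |C(0)| < ∞) < ∞`. Grimmett 1999 Thm (8.65) p. 216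
(Kesten–Zhang 1990: `P_p(m ≤ |C| < ∞) ≤ exp(−η(p) m^{2/3})`), or (8.64) via (8.18)/(8.21). Discharged from
the in-tree named fact by `supercriticalTailMoments_of_KZ` below. -/
theorem stub_supercriticalTailMoments : SupercriticalTailMoments := by
  sorry

/-- **STUB 2 `criticalTailMoments`** (OPEN — LOAD-BEARING): `θ(p_c) > 0 ⇒ ∀ j, Σ_m (m+1)^j
P_{p_c}(m ≤ |C(0)| < ∞) < ∞`. The hypothetical percolating critical point must have super-polynomially
thin finite clusters. Implied by the `p_c`-instance of the sibling crux stmt-0943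
(`criticalTailMoments_of_volumeTailItem`); vacuous if `θ(p_c) = 0`. Why it might fail: the only engines in
print (Grimmett 1999 (8.61)–(8.65), Pisztora 1996) need a slab percolating AT `p`, none does at `p_c`
(Barsky–Grimmett–Newman 1991 / DST 2016); barrier `SprinklingRenormalisation` head-on; `θ > 0` with fat
finite clusters does occur in the Aizenman–Newman `1/r²` model (Imbrie–Newman 1988 Cor 1.5). -/
theorem stub_criticalTailMoments : CriticalTailMoments := by
  sorry

/-- **STUB 3 `truncMomentsOfTailMoments`** (M/L, PROVABLE NOW): at every `p`,
`(∀ j, Σ_m (m+1)^j P_p(m ≤ |C| < ∞) < ∞) ⇒ ∀ k, Σ_(x : Fin k → ℤ³) P_p(⋂ᵢ{0 ↔ xᵢ} ∖ {0 ↔ ∞}) < ∞`.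
Tonelli over the countable index (`lintegral_tsum`; events measurable by `measurableSet_openConn_holds`,
`measurableSet_percolatesAt_holds`) identifies the sum with `E_p[|C(0)|^k ; |C(0)| < ∞]`, and the layer cake
bounds that by `k Σ_m (m+1)^{k−1} P_p(m ≤ |C| < ∞)`; `k = 0` is `Summable.of_finite`. -/
theorem stub_truncMomentsOfTailMoments : TruncMomentsOfTailMoments := by
  sorry

/-! ### Name-keyed aliases of the stub statements
`__Registered.stub_X` is statement `X` under the registered stub's short name, so that the native skeleton
audit (`#h21_check_skeleton`: hypotheses admissible iff registered obligations / declared stubs BY NAME)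
accepts `FiniteClusterMomentsOfTheta_of : __Registered.stub_… → … → FiniteClusterMomentsOfTheta`
(device of `Cruxes/TruncatedSusceptibilityFiniteOfTheta/Lines/birth.lean`; the `@[stub]` attribute is gate-reserved). -/
namespace __Registered

/-- Alias of `SupercriticalTailMoments` keyed by the registered stub name. -/
abbrev stub_supercriticalTailMoments : Prop := SupercriticalTailMoments
/-- Alias of `CriticalTailMoments` keyed by the registered stub name. -/
abbrev stub_criticalTailMoments : Prop := CriticalTailMoments
/-- Alias of `TruncMomentsOfTailMoments` keyed by the registered stub name. -/
abbrev stub_truncMomentsOfTailMoments : Prop := TruncMomentsOfTailMoments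

end __Registered

/-! ## Proved plumbing -/

/-- `θ(p) > 0 ⇒ p_c ≤ p` (`p_c = inf ({p | θ(p) > 0} ∪ {1})`, Grimmett 1999 (1.11); no coupling needed). -/
theorem criticalProb_le_of_theta_pos' {p : unitInterval} (h : 0 < theta (zdGraph 3) (0 : Site 3) p) :
    criticalProb (zdGraph 3) (0 : Site 3) ≤ (p : ℝ) := by
  refine csInf_le ⟨0, ?_⟩ (Or.inl ⟨p.2, by simpa using h⟩)
  rintro r (⟨hr, -⟩ | hr)
  · exact hr.1
  · rw [Set.mem_singleton_iff] at hr
    rw [hr]; exact zero_le_one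

/-- The regime split: a percolating `p` is either the critical point itself or strictly supercritical. -/
theorem eq_criticalProbI_or_lt {p : unitInterval} (h : 0 < theta (zdGraph 3) (0 : Site 3) p) :
    p = criticalProbI 3 ∨ criticalProb (zdGraph 3) (0 : Site 3) < (p : ℝ) := by
  rcases (criticalProb_le_of_theta_pos' h).eq_or_lt with heq | hlt
  · exact Or.inl (Subtype.ext (by rw [coe_criticalProbI]; exact heq.symm))
  · exact Or.inr hlt

theorem volTail_nonneg (p : unitInterval) (m : ℕ) : 0 ≤ volTail p m := measureReal_nonneg

/-- Elementary series estimate: a stretched-exponential tail has all polynomial tail-moments. If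
`0 ≤ a_m ≤ exp(−c m^{2/3})` for `m ≥ 1` (`c > 0`) then `Σ_m (m+1)^j a_m < ∞` for every `j`
(`x^N/N! ≤ eˣ` with `N = 3(j+2)` turns the tail into `≤ N! c^{−N} m^{−(2j+4)}`; compare with `Σ 1/m²`). -/
theorem summable_pow_mul_of_stretchedExp {a : ℕ → ℝ} {c : ℝ} (hc : 0 < c) (ha : ∀ m, 0 ≤ a m)
    (hle : ∀ m : ℕ, 1 ≤ m → a m ≤ Real.exp (-(c * (m : ℝ) ^ ((2 : ℝ) / 3)))) (j : ℕ) :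
    Summable fun m : ℕ => ((m : ℝ) + 1) ^ j * a m := by
  set N : ℕ := 3 * (j + 2) with hN
  set D : ℝ := 2 ^ j * (N.factorial : ℝ) / c ^ N with hD
  have hc0 : c ≠ 0 := hc.ne'
  -- pointwise bound for `m ≥ 1`
  have key : ∀ m : ℕ, 1 ≤ m → ((m : ℝ) + 1) ^ j * a m ≤ D * (1 / (m : ℝ) ^ 2) := by
    intro m hm
    have hm1 : (1 : ℝ) ≤ m := by exact_mod_cast hm
    have hm0 : (0 : ℝ) < m := by linarith
    have hmne : (m : ℝ) ≠ 0 := hm0.ne'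
    have hx0 : 0 ≤ c * (m : ℝ) ^ ((2 : ℝ) / 3) := by positivity
    have hxpow : (c * (m : ℝ) ^ ((2 : ℝ) / 3)) ^ N = c ^ N * (m : ℝ) ^ (2 * j + 4) := by
      rw [mul_pow, ← Real.rpow_mul_natCast hm0.le]
      congr 1
      rw [show (2 : ℝ) / 3 * (N : ℝ) = ((2 * j + 4 : ℕ) : ℝ) by rw [hN]; push_cast; ring]
      exact Real.rpow_natCast _ _
    have hexp : Real.exp (-(c * (m : ℝ) ^ ((2 : ℝ) / 3))) ≤
        (N.factorial : ℝ) / (c ^ N * (m : ℝ) ^ (2 * j + 4)) := by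
      have h1 := Real.pow_div_factorial_le_exp _ hx0 N
      rw [hxpow] at h1
      rw [Real.exp_neg]
      have hpos : 0 < c ^ N * (m : ℝ) ^ (2 * j + 4) / (N.factorial : ℝ) := by positivity
      calc (Real.exp (c * (m : ℝ) ^ ((2 : ℝ) / 3)))⁻¹
          ≤ (c ^ N * (m : ℝ) ^ (2 * j + 4) / (N.factorial : ℝ))⁻¹ := inv_anti₀ hpos h1
        _ = (N.factorial : ℝ) / (c ^ N * (m : ℝ) ^ (2 * j + 4)) := by rw [inv_div]
    have hpoly : ((m : ℝ) + 1) ^ j ≤ 2 ^ j * (m : ℝ) ^ j := by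
      rw [← mul_pow]
      exact pow_le_pow_left₀ (by positivity) (by linarith) j
    calc ((m : ℝ) + 1) ^ j * a m
        ≤ (2 ^ j * (m : ℝ) ^ j) * ((N.factorial : ℝ) / (c ^ N * (m : ℝ) ^ (2 * j + 4))) :=
          mul_le_mul hpoly ((hle m hm).trans hexp) (ha m) (by positivity)
      _ = D * (1 / (m : ℝ) ^ 2) * (1 / (m : ℝ) ^ (j + 2)) := by
          rw [hD]
          field_simp
          ring
      _ ≤ D * (1 / (m : ℝ) ^ 2) * 1 := by
          refine mul_le_mul_of_nonneg_left ?_ (by positivity)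
          rw [div_le_one (by positivity)]
          exact one_le_pow₀ hm1
      _ = D * (1 / (m : ℝ) ^ 2) := mul_one _
  -- compare the shifted series with `D/m²`
  have h2 : Summable fun n : ℕ => 1 / (n : ℝ) ^ 2 := Real.summable_one_div_nat_pow.mpr one_lt_two
  have hdom : Summable fun n : ℕ => D * (1 / ((n + 1 : ℕ) : ℝ) ^ 2) :=
    ((summable_nat_add_iff 1).mpr h2).mul_left D
  have hshift : Summable fun n : ℕ => (((n + 1 : ℕ) : ℝ) + 1) ^ j * a (n + 1) :=
    hdom.of_nonneg_of_le (fun n => mul_nonneg (by positivity) (ha _)) fun n => key (n + 1) (by omega)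
  exact (summable_nat_add_iff (f := fun m : ℕ => ((m : ℝ) + 1) ^ j * a m) 1).mp hshift

/-- STUB 1 is DISCHARGED by the in-tree named fact Kesten–Zhang 1990 = Grimmett 1999 Thm (8.65)
(`Literature.Probability.Percolation.Grimmett1999_thm_8_65`, statement only; `.z3` its `ℤ³` specialisation). -/
theorem supercriticalTailMoments_of_KZ (h : Grimmett1999_thm_8_65) : SupercriticalTailMoments := by
  intro p hp j
  obtain ⟨c, hc, hle⟩ := Grimmett1999_thm_8_65.z3 h p hp
  exact summable_pow_mul_of_stretchedExp hc (volTail_nonneg p) hle j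

/-- STUB 2 is implied by (the `p_c`-instance of) the sibling crux stmt-CriticalPhenomena-0943
`PercDebrisSweep.FiniteClusterVolumeTail` (Kesten–Zhang surface-order tail wherever `θ > 0`). -/
theorem criticalTailMoments_of_volumeTailItem
    (h : Summit.CriticalPhenomena.PercolationContinuityZ3.Theses.PercDebrisSweep.FiniteClusterVolumeTail) :
    CriticalTailMoments := by
  intro hθ j
  obtain ⟨c, hc, hle⟩ := h (criticalProbI 3) hθ
  exact summable_pow_mul_of_stretchedExp hc (volTail_nonneg _) hle j

/-- Honest piece: the supercritical regime of the crux is a CONSEQUENCE of the crux (`p > p_c ⇒ θ(p) > 0`,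
`theta_pos_of_criticalProb_lt_holds`). -/
theorem supercritTruncMoments_of_crux (h : FiniteClusterMomentsOfTheta) (p : unitInterval)
    (hp : criticalProb (zdGraph 3) (0 : Site 3) < (p : ℝ)) : TruncMomentsFinite p :=
  h p (theta_pos_of_criticalProb_lt_holds (zdGraph 3) (0 : Site 3) p hp)

/-- STUBS 2 and 3 give exactly the live case of the crux: `θ(p_c) > 0 ⇒` all truncated moments at `p_c`. -/
theorem truncMoments_critical_of (h₂ : CriticalTailMoments) (h₃ : TruncMomentsOfTailMoments)
    (hθ : 0 < theta (zdGraph 3) (0 : Site 3) (criticalProbI 3)) : TruncMomentsFinite (criticalProbI 3) :=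
  h₃ _ (h₂ hθ)

/-- Degenerate order `k = 0` of the crux's conclusion holds outright (finite index type) — information only. -/
example (p : unitInterval) : Summable (tauFk p 0) := Summable.of_finite

/-! ## The composition, by name -/

/-- **`FiniteClusterMomentsOfTheta_of`**: the three registered stubs imply the crux
`Summit.CriticalPhenomena.PercolationContinuityZ3.Theses.PercVarianceSandwich.FiniteClusterMomentsOfTheta`
(kernel-checked; no `sorry` outside the stubs). Regime split at `p_c`. -/
theorem FiniteClusterMomentsOfTheta_of (hsup : __Registered.stub_supercriticalTailMoments)
    (hcrit : __Registered.stub_criticalTailMoments) (hmom : __Registered.stub_truncMomentsOfTailMoments) :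
    Summit.CriticalPhenomena.PercolationContinuityZ3.Theses.PercVarianceSandwich.FiniteClusterMomentsOfTheta := by
  intro p hθ
  rcases eq_criticalProbI_or_lt hθ with rfl | hlt
  · exact hmom _ (hcrit hθ)
  · exact hmom p (hsup p hlt)

/-- Wiring check: the registered stubs feed `FiniteClusterMomentsOfTheta_of` as stated. -/
example : Summit.CriticalPhenomena.PercolationContinuityZ3.Theses.PercVarianceSandwich.FiniteClusterMomentsOfTheta :=
  FiniteClusterMomentsOfTheta_of stub_supercriticalTailMoments stub_criticalTailMoments
    stub_truncMomentsOfTailMoments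

end Summit.CriticalPhenomena.PercolationContinuityZ3.Cruxes.FiniteClusterMomentsOfTheta.Birth

end
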